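import Summits.QuantumFields.BalabanUV.T4Continuum.Spine.NE1p.DressedSmallFieldNestedToriRodWitness

/-!
# T⁴ programme, spine estimate NE1′ (node O3b/H2) — THE TOWER: S44's NESTED-TORI END OFF THE BOUNDARY ON BOTH COUNTS (outer rate
# `r₁ = ½ > 0` AND a coarse polymer of torus tree length EXACTLY ONE), PART 1 of 3: the rates off the boundary, the centre cube of ANY
# block, the three-torus datum `M ← L·M ← L·(L·M)`, the labels and S44's `hadm`

Cell `pub-balaban`, sub-cell `t4`, BINDER-OWNERS row NE1′ (owner skeleton `t4/skeletons/NE1p-t4-ne1p-p1.md` §3 N0u∕N0v∕N0w, pv22's nested tori);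
crew `b2b-balaban-t4-ne1p-formalise-*`, row **W75 ∕ DAG N29zzzzd** of `t4/formal/NE1p/LEAVES.md` (INTENT `HOME/CLAIMS.log` l.22679, RESERVED
typer RULING R-T139 l.22796, booked at PROTOTYPE rc 0 + STAGED l.22850), unit `b2b-balaban-t4-ne1p-formalise-leaf-10` (gen 12).  ADDITIVE — imports W67 PART 2
`Spine/NE1p/DressedSmallFieldNestedToriRodWitness` (p239256; → W67 PART 1 `…NestedToriRod`: the rod `CR`, `pR`, `natLift_proj_pR`,
`torusTreeLen_CR = 1`; W59.1∕W59.2 `…NestedToriWitness{,Live}`: the rates `rN`∕`RN`∕`vN`∕`R₀N`∕`εN`, the clause equalities, `mN`, `LabelN`,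
`εN_le_one`, `vN_le`; S44 `…NestedTori` = THE END; S43.1 `natLift_proj_of_range`; W24 `isTDom_singleton`; W50.1 `coveringFamilies_emptyFootprint`;
pv22's torus transfer) ONLY; toy DATA `def`s + theorems; 0 `def … : Prop`, 0 cite, 0 sorry, 0 `attribute`; nothing of S44 ∕ S43 ∕ W24 ∕ W50 ∕
W59 ∕ W67 ∕ pv22 is restated — their declarations are used BY NAME.

WHY.  Every decided applier of the (B3-count) chain's ENDs so far (W45 … W69, and this lineage's W59∕W67 on the nested tori) fires AT THE
BOUNDARY of the END's rate bookkeeping: outer rate `r₁ = 0`, so the conclusion's decay factor reads `exp (−(0·d(X₀)))` — the referee's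
standing INFO (a) (`t4/formal/NE1p/REFEREE.md` passes 20–24 «liveness is in the activity datum, not in the decay»).  For S44's END this is
NOT a free choice at W59's letters: the clauses `hrate : r₁ + 2κ + 2 ≤ Rkp` and `hRR : Rkp ≤ R − 64·v·e^{5R}` at `(R, v) = (RN, vN)`
(`64·vN·e^{5RN} = 1`) FORCE `r₁ ≤ 0` (§1 `r₁_nonpos_of_W59_letters`, LOCATED).  This row moves the datum OFF the boundary on BOTH counts:
* §1 THE RATES: the uncovered-cube letter HALVED `v′ := vN∕2` (`64·v′·e^{5R} = ½`), `Rkp′ := 2κ + 2 + ½` and `r₁ := ½` (`hrate`∕`hRR` WITH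
  EQUALITY), the slope `A₁′ := A·e^{−5∕2}∕4` PAYING the «ε small» clause `hsmall` at `r₁ = ½` (`= ½ ≤ 1`); `hκ`∕`hκR`∕`hrate2`∕`h229`
  stay W59.1's BY NAME (they see neither `v` nor `r₁`);
* §2 (any `d`) THE CENTRE CUBE OF ANY BLOCK `b` of a torus blocked by `L` (`ctr b`, window coordinates `L·b̃ᵢ + ⌊L∕2⌋`, `b̃ = natLift b`):
  **`tclosure L N′ {ctr b} = {b}`** for `3 ≤ L` — W59.1 §1 (block `0`) for EVERY block (`natLift_proj_of_range`, `tcoarse_proj`,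
  `proj_natLift` BY NAME);
* §3 (d = 4) THE TOWER: S44's pair of tori read at `N′ := L·M` — the COARSE torus `tsys 4 (L·M)` carries W67's three-cube ROD `C_R = CR L M`
  AS THE COARSE POLYMER `X₀` (`torusTreeLen_CR = 1` BY NAME, `5 ≤ L`), the FINEST torus `tsys 4 (L·(L·M))` carries the centre cubes
  `Cctr b` of the rod's blocks (`tclosureDom_Cctr : tclosureDom L (L·M) (Cctr b) = {b}`); the rod's unit cubes `{q₀}, {q₁}, {q₂}`
  (`unitDom`, W24's `isTDom_singleton`) form the covering family `F3` of `C_R` (`F3_biUnion`, `card_F3 = 3`, `card_rodT = 3`);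
* §4 THE LABELS: covered `⟨∅, ⟨F3, {b} ↦ ⟨Cctr b, ()⟩⟩⟩` — a THREE-member family, under each member the centre cube of ITS OWN block
  (read off the member's cube `Z.2.1.choose`) —, uncovered `⟨C_R, ⟨∅, –⟩⟩`; the index `termsT` (both labels AT THE ROD, nothing at any
  other coarse polymer); **`hadm_T`** — S44's `hadm` incl. its third clause by `tclosureDom_Cctr`, the empty family by W50.1's
  `coveringFamilies_emptyFootprint`.
PART 2 (`…NestedToriTowerEnd`): the majorants at `v′`, the cores carrying `e^{−5∕2}`, `hAmp`, THE END ONCE with conclusion factor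
`exp (−(½·torusTreeLen C_R)) = e^{−1∕2} < 1` and closed form `K₀(64,8)·e^{−3}`, the activity's closed form and live attached part;
PART 3 (`…NestedToriTowerLive`): `E₁(C_R) ≠ E₀(C_R)` by leaf-09's single-support lemma.

HONEST FRAMING.  A DECIDED TOY over S44's hypothesis SHAPES + finite ℤ∕N lattice geometry on pv22's CONSTRUCTED tori ([folklore]∕[arith]
tags; 0 sorry; 0 citations — bracketed names are labels; no `def … : Prop` — the `def`s are toy DATA).  The rod (W67's), the centre cubes,
the labels, the rates and every numeral (`vN∕2`, `2κ + 2 + ½`, `A·e^{−5∕2}∕4`, `r₁ = ½`) are OURS in S44's literal currency (`64·log 162`,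
`K₀(64,8)`); `hinner` is W59's CHOSEN weight `mN` (an equality by fiat in N0u's shape, not derived from a density: S41); (B1b) NOT claimed;
(B3-amp) MET by CHOSEN weights — UNPRINTED for Bałaban's cores (G-ne9p2-5); the rate leaves the boundary ONLY because the letters are
RE-CHOSEN (`v` halved, slope shrunk by `e^{−5∕2}`) — a statement about the SHAPE's bookkeeping on a toy, NOT about slack on Bałaban's
densities; print's ½L, (L+2)⁴, «L an odd positive integer > 11» ([Balaban1987RGI] p. 251), (1.28), (2.27), (2.35)–(2.41) of
[Balaban1988RGII] are TYPE∕CONTEXT only; WHICH tori are Bałaban's (𝐃_{k+1}, 𝐃_k) = pv22's READING (D-pv22.3); no numeral of the audited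
manuscripts is asserted as a fact about Bałaban's densities; 0 binders instantiated on Bałaban's densities; discharges no wall item; wall
v1.8 (T4-DAG v48) — words, not kind — does NOT move; R-t4r2-Q2 NOT met; NE1′ ⇐ the named binders — NOT proved, NOT printed; spine PROVED
0∕9; count 9 unchanged; ABSOLUTE RULE honoured (nothing internally minted is cited; `FlowStep.BetaPertH` ∕ (B) ∕ G-an2-4 in prose only).
Rung (B)+1 on ONE finite four-torus — NOT infinite volume, NOT a mass gap, NOT OS on ℝ⁴, NOT Clay.  HONEST DEPENDENCY: continuum YM on T⁴ ⇐
BetaPertH ∧ nine spine estimates (0/9 proved); BetaPertH ⇐ (D1) ∧ (D4) ∧ CAP+tail; G-an2-4 gates asym, D1 and NE2/3/4.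
-/

noncomputable section

namespace Summit.QuantumFields.BalabanUV.T4Continuum.NE1p.DressedSmallFieldNestedToriTower

open Literature.MathematicalPhysics.QuantumFieldTheory.Balaban1983to89
open Literature.MathematicalPhysics.QuantumFieldTheory.Balaban1983to89.B12TreeDecay (K₀ K₀_pos)
open Literature.MathematicalPhysics.QuantumFieldTheory.Balaban1983to89.B13FamilySum (coveringFamilies mem_coveringFamilies)
open Literature.MathematicalPhysics.QuantumFieldTheory.Balaban1983to89.B13ScaleTransfer (Pt block mem_block coarse)
open Literature.MathematicalPhysics.QuantumFieldTheory.Balaban1983to89.TreeLengthTorus (TPt TDom proj proj_apply natLift proj_natLift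
  tsys torusTreeLen torusTreeLen_singleton)
open Literature.MathematicalPhysics.QuantumFieldTheory.Balaban1983to89.TreeLengthTorusGeometry (tgeometry)
open Literature.MathematicalPhysics.QuantumFieldTheory.Balaban1983to89.TreeLengthTorusTransfer (tcoarse tcoarse_proj tblock
  mem_tblock_self tcollar tclosure tclosureDom tclosureDom_val)
open Summit.QuantumFields.BalabanUV.T4Continuum.TorusBlockRefinement (natLift_proj_of_range)
open Summit.QuantumFields.BalabanUV.T4Continuum.NE1p.DressedSmallFieldTorusWitness (isTDom_singleton)
open Summit.QuantumFields.BalabanUV.T4Continuum.NE1p.DressedSmallFieldCoresWitness (Acst Acst_pos)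
open Summit.QuantumFields.BalabanUV.T4Continuum.NE1p.DressedSmallFieldInnerLabelsWitness (coveringFamilies_emptyFootprint)
open Summit.QuantumFields.BalabanUV.T4Continuum.NE1p.DressedSmallFieldNestedToriWitness (RN vN εN εN_pos vN_pos hRR_N_eq mN LabelN
  vN_le)
open Summit.QuantumFields.BalabanUV.T4Continuum.NE1p.DressedSmallFieldNestedToriRod (pR pR_zero rodW rodT CR CR_val natLift_proj_pR)

/-! ## §1 THE RATES OFF THE BOUNDARY -/

section Rates

/-- **LOCATED: AT W59's LETTERS THE BOUNDARY IS FORCED** — S44's `hrate` (`r₁ + 2κ + 2 ≤ Rkp`) and `hRR` (`Rkp ≤ R − 64·v·e^{5R}`) at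
`(R, v) = (RN, vN)` (`64·vN·e^{5RN} = 1`, W59.1's `hRR_N_eq`) leave NO room for the outer rate: `r₁ ≤ 0`. [arith] -/
theorem r₁_nonpos_of_W59_letters {r₁ Rkp : ℝ} (hrate : r₁ + 2 * (64 * Real.log 162) + 2 ≤ Rkp)
    (hRR : Rkp ≤ RN - 64 * (vN * Real.exp (RN * 5))) : r₁ ≤ 0 := by
  have h := hRR_N_eq
  linarith

/-- THE HALVED UNCOVERED-CUBE LETTER (toy DATA): `v′ := vN ∕ 2 = e^{−5R}∕128`. [folklore] -/
def vT : ℝ := vN / 2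

/-- `0 < v′`. [arith] -/
theorem vT_pos : 0 < vT := by unfold vT; linarith [vN_pos]

/-- `v′ ≤ 1∕128`. [arith] -/
theorem vT_le : vT ≤ 1 / 128 := by unfold vT; linarith [vN_le]

/-- `64·v′·e^{5R} = ½` — HALF of `hRR`'s unit of room is left for the outer rate. [arith] -/
theorem sixtyfour_vT_exp : 64 * (vT * Real.exp (RN * 5)) = 1 / 2 := by
  have h : 64 * (vN * Real.exp (RN * 5)) = 1 := by have := hRR_N_eq; unfold RN at this ⊢; linarith
  unfold vT
  rw [show vN / 2 * Real.exp (RN * 5) = vN * Real.exp (RN * 5) / 2 by ring]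
  linarith

/-- THE STEP RATE OFF THE BOUNDARY (toy DATA): `Rkp′ := 2κ + 2 + ½` (κ = 64·log 162). [folklore] -/
def RkpT : ℝ := 2 * (64 * Real.log 162) + 2 + 1 / 2

/-- **S44's `hrate` AT THE INTERIOR VALUE `r₁ = ½`** (with equality). [arith] -/
theorem hrate_T : 1 / 2 + 2 * (64 * Real.log 162) + 2 ≤ RkpT := by unfold RkpT; linarith

/-- **S44's `hRR` at `(R, v′)`** (with equality: `Rkp′ = R − ½`). [arith] -/
theorem hRR_T : RkpT ≤ RN - 64 * (vT * Real.exp (RN * 5)) := by rw [sixtyfour_vT_exp]; unfold RkpT RN; linarith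

/-- THE SLOPE THAT PAYS `hsmall` AT `r₁ = ½` (toy DATA): `A₁′ := A·e^{−5∕2}∕4` (W33's `Acst = (e·K₀(64,8)·9·64)⁻¹`). [folklore] -/
def A₁T : ℝ := Acst * Real.exp (-(5 / 2)) / 4

/-- `0 < A₁′`. [arith] -/
theorem A₁T_pos : 0 < A₁T := by unfold A₁T; have := Acst_pos; positivity

/-- **S44's «ε small» CLAUSE AT `r₁ = ½`**: `(0 + 2·A₁′)·e^{5·½ + 1}·K₀(64,8)·9·64 = ½ ≤ 1`. [arith] -/
theorem hsmall_T : (0 + 2 * A₁T) * Real.exp (5 * (1 / 2) + 1) * K₀ 64 8 * 9 * 64 ≤ 1 := by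
  have hK := K₀_pos (64 : ℝ) 8
  have he := Real.exp_pos 1
  have hsplit : Real.exp (5 * (1 / 2) + 1) = Real.exp (5 / 2) * Real.exp 1 := by rw [← Real.exp_add]; norm_num
  have h1 : Real.exp (-(5 / 2 : ℝ)) * Real.exp (5 / 2) = 1 := by rw [← Real.exp_add]; norm_num
  unfold A₁T Acst
  rw [hsplit]
  calc (0 + 2 * ((Real.exp 1 * K₀ 64 8 * 9 * 64)⁻¹ * Real.exp (-(5 / 2)) / 4)) * (Real.exp (5 / 2) * Real.exp 1) *
        K₀ 64 8 * 9 * 64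
      = 1 / 2 * (Real.exp (-(5 / 2 : ℝ)) * Real.exp (5 / 2)) *
          ((Real.exp 1 * K₀ 64 8 * 9 * 64)⁻¹ * (Real.exp 1 * K₀ 64 8 * 9 * 64)) := by ring
    _ = 1 / 2 := by rw [h1, inv_mul_cancel₀ (by positivity)]; norm_num
    _ ≤ 1 := by norm_num

end Rates

/-! ## §2 THE CENTRE CUBE OF ANY BLOCK: its closure is the block (W59.1 §1 for block `0`, here for every block `b`) -/

section Centre
variable {d : ℕ} (L N' : ℕ) [NeZero L] [NeZero N']

/-- THE CENTRE CUBE OF THE BLOCK `b` (toy DATA): the fine cube with window coordinates `L·b̃ᵢ + ⌊L∕2⌋`, `b̃ = natLift b`. [folklore] -/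
def ctr (b : TPt d N') : TPt d (L * N') := proj (L * N') fun i => (L : ℤ) * natLift b i + ((L / 2 : ℕ) : ℤ)

omit [NeZero L] in
/-- The standard lift of a coarse cube lies in `[0, N′)` coordinatewise. [folklore] -/
theorem natLift_nonneg_lt (b : TPt d N') (i : Fin d) : 0 ≤ natLift b i ∧ natLift b i + 1 ≤ (N' : ℤ) := by
  refine ⟨Int.natCast_nonneg _, ?_⟩
  have := ZMod.val_lt (b i)
  show (((b i).val : ℕ) : ℤ) + 1 ≤ N'
  exact_mod_cast this

/-- The standard lift of the centre cube IS `(L·b̃ᵢ + ⌊L∕2⌋)ᵢ` (S43.1 `natLift_proj_of_range`). [folklore] -/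
theorem natLift_ctr (hL : 3 ≤ L) (b : TPt d N') :
    natLift (ctr L N' b) = fun i => (L : ℤ) * natLift b i + ((L / 2 : ℕ) : ℤ) := by
  unfold ctr
  refine natLift_proj_of_range fun i => ?_
  obtain ⟨h0, h1⟩ := natLift_nonneg_lt N' b i
  have hL0 : (0 : ℤ) ≤ L := by positivity
  have h2 : ((L / 2 : ℕ) : ℤ) < L := by exact_mod_cast Nat.div_lt_self (by omega) one_lt_two
  have h2' : (0 : ℤ) ≤ ((L / 2 : ℕ) : ℤ) := by positivity
  have h3 : (L : ℤ) * natLift b i + L ≤ (L : ℤ) * N' := by nlinarith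
  refine ⟨by positivity, ?_⟩
  show (L : ℤ) * natLift b i + ((L / 2 : ℕ) : ℤ) < ((L * N' : ℕ) : ℤ)
  rw [Nat.cast_mul]
  linarith

/-- **EVERY CUBE OF THE CENTRE CUBE's 3^d-NEIGHBOURHOOD COARSENS TO THE BLOCK `b`** (`3 ≤ L`: the neighbours' coordinates
`L·b̃ᵢ + ⌊L∕2⌋ ± 1` lie in `[L·b̃ᵢ, L·b̃ᵢ + L)`; pv22's `tcoarse_proj`, `proj_natLift`). [folklore] -/
theorem tcoarse_eq_of_mem_tblock_ctr (hL : 3 ≤ L) (b : TPt d N') {a : TPt d (L * N')} (ha : a ∈ tblock (ctr L N' b)) :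
    tcoarse L N' a = b := by
  unfold tblock at ha
  rw [natLift_ctr L N' hL b] at ha
  obtain ⟨y, hy, rfl⟩ := Finset.mem_image.1 ha
  rw [tcoarse_proj]
  have hy' := mem_block.1 hy
  have h1 : (1 : ℤ) ≤ ((L / 2 : ℕ) : ℤ) := by exact_mod_cast (show 1 ≤ L / 2 by omega)
  have h2 : ((L / 2 : ℕ) : ℤ) + 1 < (L : ℤ) := by exact_mod_cast (show L / 2 + 1 < L by omega)
  have hL' : (0 : ℤ) < L := by exact_mod_cast (show 0 < L by omega)
  have hc : coarse L y = natLift b := by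
    funext i
    obtain ⟨hl, hu⟩ := hy' i
    show y i / (L : ℤ) = natLift b i
    rw [show y i = (y i - (L : ℤ) * natLift b i) + natLift b i * L by ring, Int.add_mul_ediv_right _ _ hL'.ne',
      Int.ediv_eq_zero_of_lt (by linarith) (by linarith), zero_add]
  rw [hc, proj_natLift]

/-- **THE CLOSURE OF THE CENTRE CUBE IS ITS BLOCK**: `tclosure L N′ {ctr b} = {b}` for every `3 ≤ L`, every `N′`, every block `b`. [folklore] -/
theorem tclosure_ctr (hL : 3 ≤ L) (b : TPt d N') : tclosure L N' ({ctr L N' b} : Finset (TPt d (L * N'))) = {b} := by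
  unfold tclosure tcollar
  rw [Finset.singleton_biUnion]
  refine Finset.eq_singleton_iff_unique_mem.2 ⟨?_, fun b' hb' => ?_⟩
  · exact Finset.mem_image.2 ⟨ctr L N' b, mem_tblock_self _, tcoarse_eq_of_mem_tblock_ctr L N' hL b (mem_tblock_self _)⟩
  · obtain ⟨a, ha, rfl⟩ := Finset.mem_image.1 hb'
    exact tcoarse_eq_of_mem_tblock_ctr L N' hL b ha

end Centre

/-! ## §3 THE TOWER DATUM (d = 4): coarse torus `tsys 4 (L·M)` carrying W67's ROD, finest torus `tsys 4 (L·(L·M))` carrying the centre cubes -/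

section Datum
variable (L M : ℕ) [NeZero L] [NeZero M]

/-- THE UNIT COARSE DOMAIN `{b}` (toy DATA; W24's `isTDom_singleton`). [folklore] -/
def unitDom (b : TPt 4 (L * M)) : TDom 4 (L * M) := ⟨{b}, isTDom_singleton _ b⟩

/-- `(unitDom b).1 = {b}`. [folklore] -/
@[simp] theorem unitDom_val (b : TPt 4 (L * M)) : (unitDom L M b).1 = {b} := rfl

/-- THE FINE COMPONENT UNDER `{b}` (toy DATA): the centre cube of block `b`, a one-cube domain of the FINEST torus. [folklore] -/
def Cctr (b : TPt 4 (L * M)) : TDom 4 (L * (L * M)) := ⟨{ctr L (L * M) b}, isTDom_singleton _ _⟩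

/-- `(Cctr b).1 = {ctr b}`. [folklore] -/
@[simp] theorem Cctr_val (b : TPt 4 (L * M)) : (Cctr L M b).1 = {ctr L (L * M) b} := rfl

/-- **THE CLOSURE OF THE FINE COMPONENT IS THE UNIT COARSE DOMAIN**: `tclosureDom L (L·M) (Cctr b) = {b}` (§2). [folklore] -/
theorem tclosureDom_Cctr (hL : 3 ≤ L) (b : TPt 4 (L * M)) : tclosureDom L (L * M) (Cctr L M b) = unitDom L M b :=
  Subtype.ext (by rw [tclosureDom_val]; exact tclosure_ctr L (L * M) hL b)

/-- The fine component has tree length `0`. [folklore] -/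
theorem torusTreeLen_Cctr (b : TPt 4 (L * M)) : torusTreeLen (Cctr L M b).1 = 0 := torusTreeLen_singleton _

/-- THE ROD's CUBES ON THE COARSE TORUS (toy DATA): `q_j := proj (L·M) p_j` (W67's `pR`). [folklore] -/
def qR (j : ℕ) : TPt 4 (L * M) := proj (L * M) (pR L j)

omit [NeZero L] [NeZero M] in
/-- W67's rod IS `{q₀, q₁, q₂}`. [folklore] -/
theorem rodT_eq : rodT L M = {qR L M 0, qR L M 1, qR L M 2} := by
  unfold rodT rodW qR
  rw [Finset.image_insert, Finset.image_insert, Finset.image_singleton]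

/-- The rod's cubes are pairwise distinct (`5 ≤ L`: their standard lifts differ in coordinate `0`). [folklore] -/
theorem qR_ne (hL : 5 ≤ L) {i j : ℕ} (hi : i ≤ 2) (hj : j ≤ 2) (hij : i ≠ j) : qR L M i ≠ qR L M j := by
  intro h
  have h' := congrArg (fun a => natLift a 0) h
  simp only [qR, natLift_proj_pR L M hL hi, natLift_proj_pR L M hL hj, pR_zero] at h'
  have : (i : ℤ) = j := by linarith
  exact hij (by exact_mod_cast this)

/-- The rod has THREE cubes. [folklore] -/
theorem card_rodT (hL : 5 ≤ L) : (rodT L M).card = 3 := by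
  rw [rodT_eq, Finset.card_insert_of_notMem, Finset.card_insert_of_notMem, Finset.card_singleton]
  · rw [Finset.mem_singleton]; exact qR_ne L M hL (by norm_num) (by norm_num) (by norm_num)
  · simp only [Finset.mem_insert, Finset.mem_singleton, not_or]
    exact ⟨qR_ne L M hL (by norm_num) (by norm_num) (by norm_num), qR_ne L M hL (by norm_num) (by norm_num) (by norm_num)⟩

open Classical in
/-- THE COVERING FAMILY OF THE ROD BY ITS THREE UNIT CUBES (toy DATA). [folklore] -/
def F3 : Finset (TDom 4 (L * M)) := {unitDom L M (qR L M 0), unitDom L M (qR L M 1), unitDom L M (qR L M 2)}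

open Classical in
/-- Membership in `F3`. [folklore] -/
theorem mem_F3 {Z : TDom 4 (L * M)} :
    Z ∈ F3 L M ↔ Z = unitDom L M (qR L M 0) ∨ Z = unitDom L M (qR L M 1) ∨ Z = unitDom L M (qR L M 2) := by
  unfold F3; simp only [Finset.mem_insert, Finset.mem_singleton]

open Classical in
/-- Every member of `F3` is a unit domain `{q_j}`. [folklore] -/
theorem exists_eq_unitDom_of_mem_F3 {Z : TDom 4 (L * M)} (hZ : Z ∈ F3 L M) : ∃ b, Z = unitDom L M b := by
  rcases (mem_F3 L M).1 hZ with h | h | h <;> exact ⟨_, h⟩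

open Classical in
/-- **`F3` COVERS EXACTLY THE ROD**: `⋃ F3 = C_R` (b13's (2.2) condition). [folklore] -/
theorem F3_biUnion : (F3 L M).biUnion (fun Z : (tsys 4 (L * M)).Dom => Z.1) = (CR L M).1 := by
  rw [CR_val, rodT_eq]
  unfold F3
  ext x
  simp only [Finset.mem_biUnion, Finset.mem_insert, Finset.mem_singleton]
  constructor
  · rintro ⟨Z, hZ | hZ | hZ, hx⟩ <;> subst hZ <;> simp only [unitDom_val, Finset.mem_singleton] at hx <;> simp [hx]
  · rintro (rfl | rfl | rfl)
    · exact ⟨_, Or.inl rfl, by simp [unitDom_val]⟩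
    · exact ⟨_, Or.inr (Or.inl rfl), by simp [unitDom_val]⟩
    · exact ⟨_, Or.inr (Or.inr rfl), by simp [unitDom_val]⟩

open Classical in
/-- `F3` has THREE members. [folklore] -/
theorem card_F3 (hL : 5 ≤ L) : (F3 L M).card = 3 := by
  have hinj : ∀ {a b : TPt 4 (L * M)}, unitDom L M a = unitDom L M b → a = b := fun h =>
    Finset.singleton_injective (congrArg Subtype.val h)
  unfold F3
  rw [Finset.card_insert_of_notMem, Finset.card_insert_of_notMem, Finset.card_singleton]
  · rw [Finset.mem_singleton]; exact fun h => qR_ne L M hL (by norm_num) (by norm_num) (by norm_num) (hinj h)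
  · simp only [Finset.mem_insert, Finset.mem_singleton, not_or]
    exact ⟨fun h => qR_ne L M hL (by norm_num) (by norm_num) (by norm_num) (hinj h),
      fun h => qR_ne L M hL (by norm_num) (by norm_num) (by norm_num) (hinj h)⟩

/-! ## §4 THE LABELS, THE INDEX, S44's `hadm` -/

open Classical in
/-- THE COVERED LABEL (toy DATA): nothing uncovered, the family `F3`, and for each member `{b}` the centre cube of block `b` on the finest torus
(read off the member's one cube `Z.2.1.choose`). [folklore] -/
def coveredT : LabelN L (L * M) := ⟨∅, ⟨F3 L M, fun Z _ => ⟨Cctr L M Z.2.1.choose, ()⟩⟩⟩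

/-- THE UNCOVERED LABEL (toy DATA): the whole rod uncovered, the empty family. [folklore] -/
def uncoveredT : LabelN L (L * M) := ⟨(CR L M).1, ⟨∅, fun Z h => absurd h (Finset.notMem_empty Z)⟩⟩

/-- The two labels differ (first components `∅ ≠ C_R`). [folklore] -/
theorem coveredT_ne_uncoveredT : coveredT L M ≠ uncoveredT L M := fun h =>
  (CR L M).2.1.ne_empty (congrArg Sigma.fst h).symm

open Classical in
/-- THE TERM INDEX OF RECORD (toy DATA): at the ROD the two labels, nothing at any other coarse polymer. [folklore] -/
def termsT (Z : TDom 4 (L * M)) : Finset (LabelN L (L * M)) := if Z = CR L M then {coveredT L M, uncoveredT L M} else ∅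

open Classical in
/-- The index at the rod. [folklore] -/
theorem termsT_CR : termsT L M (CR L M) = {coveredT L M, uncoveredT L M} := if_pos rfl

open Classical in
/-- The index off the rod is empty. [folklore] -/
theorem termsT_of_ne {Z : TDom 4 (L * M)} (h : Z ≠ CR L M) : termsT L M Z = ∅ := if_neg h

open Classical in
/-- **S44's `hadm` MET ON THE TOWER**, third clause included: under each member `{q_j}` of `F3` sits the centre cube of block `q_j`, whose
closure IS `{q_j}` (`tclosureDom_Cctr`); the empty family covers the empty footprint (W50.1 `coveringFamilies_emptyFootprint`). [folklore] -/
theorem hadm_T (hL : 5 ≤ L) : ∀ Z : (tsys 4 (L * M)).Dom, ∀ l ∈ termsT L M Z, l.1 ⊆ Z.1 ∧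
    l.2.1 ∈ coveringFamilies Finset.univ (fun Y : (tsys 4 (L * M)).Dom => Y.1) (Z.1 \ l.1) ∧
    ∀ Z' (h : Z' ∈ l.2.1), l.2.2 Z' h ∈
      ((Finset.univ : Finset (tsys 4 (L * (L * M))).Dom).filter (fun Z₀ => tclosureDom L (L * M) Z₀ = Z')).sigma
        (fun _ => (Finset.univ : Finset Unit)) := by
  intro Z l hl
  by_cases hZ : Z = CR L M
  · subst hZ
    rw [termsT_CR] at hl
    rcases Finset.mem_insert.1 hl with rfl | hl'
    · refine ⟨Finset.empty_subset _, ?_, fun Z' h => ?_⟩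
      · show F3 L M ∈ coveringFamilies Finset.univ (fun Y : (tsys 4 (L * M)).Dom => Y.1) ((CR L M).1 \ ∅)
        rw [Finset.sdiff_empty]
        exact mem_coveringFamilies.2 ⟨Finset.subset_univ _, F3_biUnion L M⟩
      · obtain ⟨b, hb⟩ := exists_eq_unitDom_of_mem_F3 L M h
        subst hb
        have hc : (unitDom L M b).2.1.choose = b := Finset.mem_singleton.1 (unitDom L M b).2.1.choose_spec
        refine Finset.mem_sigma.2 ⟨Finset.mem_filter.2 ⟨Finset.mem_univ _, ?_⟩, Finset.mem_univ _⟩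
        show tclosureDom L (L * M) (Cctr L M (unitDom L M b).2.1.choose) = unitDom L M b
        rw [hc, tclosureDom_Cctr L M (by omega)]
    · rw [Finset.mem_singleton] at hl'
      subst hl'
      refine ⟨subset_rfl, ?_, fun Z' h => absurd h (Finset.notMem_empty Z')⟩
      show (∅ : Finset (TDom 4 (L * M))) ∈ coveringFamilies Finset.univ (tgeometry 4 (L * M)).cubes ((CR L M).1 \ (CR L M).1)
      rw [Finset.sdiff_self, coveringFamilies_emptyFootprint (tgeometry 4 (L * M))]
      exact Finset.mem_singleton_self _
  · rw [termsT_of_ne L M hZ] at hl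
    exact absurd hl (Finset.notMem_empty l)

end Datum

end Summit.QuantumFields.BalabanUV.T4Continuum.NE1p.DressedSmallFieldNestedToriTower

end
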